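import Literature.Analysis.FluidPDE.EyinkTransverseLimit
import HarnessLib

/-!
# Eyink's transverse balance `(uuT-eq)` at scale `ε`: discharge of `Torus.eyink_transverse_balance`

Topic: Analysis/FluidPDE, proofs. Sibling proof file of `EyinkBalance` (the named fact
`Torus.eyink_transverse_balance`: G. L. Eyink, Nonlinearity 16 (2003) 137–145, §2 (uuT-eq) — for a
distributional Euler solution `(u,p)` on `T^d × (0,T)`, `d ≥ 2`, `u ∈ L³`, `p ∈ L^{3/2}`, a spherically
symmetric standard mollifier `φ`, `ε > 0` and a test function `ψ` supported in `(0,T)`,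
`𝓔_T^{ε,φ}(ψ) = (4(d−1)/d) ∫₀ᵀ∫ D_T^{ε,φ}(u) ψ`). This file PROVES it:

* `Torus.eyink_transverse_balance_holds : eyink_transverse_balance (d := d)`,

from the excised identity of `EyinkBalanceOfMatrix` (`Torus.eyinkBalanceT_eq_of_matrix_facts`, for
radial bumps vanishing near the origin, via Novack's matrix-kernel identities, both discharged in the
tree) by removing the excision at fixed `ε`:

1. **Additivity in the profile** of both sides: of the pairing `∫∫ D_T^{ε,φ} ψ`
   (`Torus.integral_transverseApprox_add`, `EyinkTransverseLimit`) and of the balance pairing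
   `𝓔_T^{ε,φ}(ψ)` (`Torus.eyinkBalanceT_add`: the objects `u_T^ε`, `(u_T·u_T)^ε`, `((u_T·u_T)u)^ε`,
   `p_T^ε` are additive in `φ` at a.e. `(t,x)`, § Objects, and the total integrand is integrable,
   `Torus.eyink_piecesT_integrable`).
2. **A mass bound** `|𝓔_T^{ε,φ}(ψ)| ≤ C ∫φ` for nonnegative radial unit-ball bumps, `C = C(u,p,ψ)`
   (`Torus.exists_abs_eyinkBalanceT_le`: the Type I–IV estimates of `EyinkBalanceLimits` with the crude
   translation moduli `2‖u‖₃`, `2‖p‖_{3/2}`).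
3. **Assembly** (`Torus.eyinkBalanceT_eq_of_matrix_facts'`): with `φ = φ(1−χ_κ) + φχ_κ`, the defect
   `𝓔_T^{ε,φ}(ψ) − (4(d−1)/d)∫∫D_T^{ε,φ}ψ` equals the defect of the remainder `φχ_κ` for every `κ > 0`,
   which tends to `0` as `κ → 0⁺` (`∫ φχ_κ → 0`, `Torus.tendsto_integral_transverseApprox_remainder`).
4. **Rescaling** to the unit ball (`Torus.mollifierScale_mul_mollifierScale_inv`: `(φ_R)^{εR} = φ^ε`
   with `φ_R = R^d φ(R·)`; all objects depend on `φ` only through `φ^ε`,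
   `Torus.eyinkBalanceT_congr_kernel`, `Torus.eyinkTransverseApprox_congr_kernel`).

## References

* G. L. Eyink, *Local 4/5-law and energy dissipation anomaly in turbulence*, Nonlinearity 16 (2003)
  137–145 = arXiv:nlin/0208004, §2 (uuT-eq), (p-LT), (Pi-p-LT). [Eyink2003]
* M. Novack, *Scaling laws and exact results in turbulence*, Nonlinearity 37 (2024) 095002, §3
  (matrix kernels). [Novack2024]
-/

noncomputable section

open MeasureTheory TopologicalSpace Set Function Filter Metric
open _root_.Topology
open scoped ENNReal NNReal Convolution ContDiff InnerProductSpace RealInnerProductSpace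

namespace Literature.Analysis.FluidPDE.Torus

variable {d : Type*} [Fintype d]

/-! ## Dependence on the kernel `φ^ε` only; rescaling to the unit ball -/

section Kernel

variable [DecidableEq d] {T : ℝ} {u : ℝ → UnitAddTorus d → EuclideanSpace ℝ d} {p : ℝ → UnitAddTorus d → ℝ}
  {ψ : ℝ → UnitAddTorus d → ℝ} {φ φ₁ φ₂ : EuclideanSpace ℝ d → ℝ} {ε ε₁ ε₂ R : ℝ}

omit [DecidableEq d] in
/-- Eyink's balance pairing depends on `(φ, ε)` only through the kernel `φ^ε`. [folklore] -/
theorem eyinkBalanceT_congr_kernel (h : FluidPDE.mollifierScale ε₁ φ₁ = FluidPDE.mollifierScale ε₂ φ₂) :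
    eyinkBalanceT T u p φ₁ ε₁ ψ = eyinkBalanceT T u p φ₂ ε₂ ψ := by
  unfold eyinkBalanceT eyinkVelocityT eyinkEnergyT eyinkEnergyFluxT eyinkPressureT
  rw [h]

omit [DecidableEq d] in
/-- Eyink's transverse approximant depends on `(φ, ε)` only through the kernel `φ^ε`. [folklore] -/
theorem eyinkTransverseApprox_congr_kernel (h : FluidPDE.mollifierScale ε₁ φ₁ = FluidPDE.mollifierScale ε₂ φ₂) :
    eyinkTransverseApprox φ₁ ε₁ = eyinkTransverseApprox φ₂ ε₂ := by
  funext v x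
  unfold eyinkTransverseApprox eyinkTransverseIntegrand
  rw [h]

omit [DecidableEq d] in
/-- **Rescaling**: `(φ_R)^{εR} = φ^ε` for `φ_R = R^d φ(R·) = mollifierScale R⁻¹ φ`, `R > 0`. [folklore] -/
theorem mollifierScale_mul_mollifierScale_inv (φ : EuclideanSpace ℝ d → ℝ) (hR : 0 < R) (ε : ℝ) :
    FluidPDE.mollifierScale (ε * R) (FluidPDE.mollifierScale R⁻¹ φ) = FluidPDE.mollifierScale ε φ := by
  funext ξ
  simp only [FluidPDE.mollifierScale_apply, smul_smul, inv_inv, mul_pow, inv_pow]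
  have hRn : (R ^ Fintype.card d) ≠ 0 := pow_ne_zero _ hR.ne'
  rw [show R * (ε * R)⁻¹ = ε⁻¹ by field_simp]
  field_simp

omit [DecidableEq d] in
/-- **The rescaled profile `φ_R = R^d φ(R·)` of a radial mollifier supported in the ball of radius
`R > 0`** is a nonnegative radial bump supported in the closed unit ball. [folklore] -/
theorem rescale_facts (hφ : FluidPDE.IsMollifier φ) (hrad : ∀ ξ η : EuclideanSpace ℝ d, ‖ξ‖ = ‖η‖ → φ ξ = φ η)
    (hR : 0 < R) (hsupp : ∀ ξ : EuclideanSpace ℝ d, R < ‖ξ‖ → φ ξ = 0) :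
    IsRadialBump (FluidPDE.mollifierScale R⁻¹ φ) ∧ (∀ ξ, 0 ≤ FluidPDE.mollifierScale R⁻¹ φ ξ) ∧
      ∀ ξ : EuclideanSpace ℝ d, 1 < ‖ξ‖ → FluidPDE.mollifierScale R⁻¹ φ ξ = 0 := by
  refine ⟨(hφ.isRadialBump hrad).mollifierScale (inv_ne_zero hR.ne'), fun ξ => ?_, fun ξ hξ => ?_⟩
  · rw [FluidPDE.mollifierScale_apply]
    exact mul_nonneg (inv_nonneg.2 (pow_nonneg (inv_nonneg.2 hR.le) _)) (hφ.2.2.2.1 _)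
  · rw [FluidPDE.mollifierScale_apply, hsupp _ ?_, mul_zero]
    rw [inv_inv, norm_smul, Real.norm_eq_abs, abs_of_pos hR]
    calc R = R * 1 := (mul_one R).symm
      _ < R * ‖ξ‖ := by gcongr

end Kernel

/-! ## Additivity of Eyink's objects in the profile -/

section Objects

variable [DecidableEq d] {φ₁ φ₂ : EuclideanSpace ℝ d → ℝ} {ε : ℝ}

omit [DecidableEq d] in
/-- The rescaled kernel of a sum is the sum of the rescaled kernels. [folklore] -/
theorem mollifierScale_add (φ₁ φ₂ : EuclideanSpace ℝ d → ℝ) (ε : ℝ) :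
    FluidPDE.mollifierScale ε (fun ξ => φ₁ ξ + φ₂ ξ) =
      fun ξ => FluidPDE.mollifierScale ε φ₁ ξ + FluidPDE.mollifierScale ε φ₂ ξ := by
  funext ξ
  simp only [FluidPDE.mollifierScale_apply]
  ring

omit [DecidableEq d] in
/-- Facts about the kernel `φ^ε` of a radial bump: continuous, radial bump, support in a closed
ball. [folklore] -/
theorem kernel_facts {φ : EuclideanSpace ℝ d → ℝ} (hφ : IsRadialBump φ) (hε : 0 < ε) :
    Continuous (FluidPDE.mollifierScale ε φ) ∧ ∃ R : ℝ, 0 ≤ R ∧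
      tsupport (FluidPDE.mollifierScale ε φ) ⊆ closedBall (0 : EuclideanSpace ℝ d) R ∧
      ∀ ξ : EuclideanSpace ℝ d, R ≤ ‖ξ‖ → FluidPDE.mollifierScale ε φ ξ = 0 := by
  have hk := hφ.mollifierScale hε.ne'
  obtain ⟨R, hR0, hR⟩ := hk.exists_eq_zero
  exact ⟨hk.smooth.continuous, R, hR0, tsupport_subset_closedBall_of_eq_zero hR, hR⟩

/-- **Additivity of `u_T^ε` in the profile** at an integrable slice. [folklore] -/
theorem eyinkVelocityT_add (hφ₁ : IsRadialBump φ₁) (hφ₂ : IsRadialBump φ₂) (hε : 0 < ε)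
    {v : UnitAddTorus d → EuclideanSpace ℝ d} (hv : Integrable v volume) (x : UnitAddTorus d) :
    eyinkVelocityT (fun ξ => φ₁ ξ + φ₂ ξ) ε v x = eyinkVelocityT φ₁ ε v x + eyinkVelocityT φ₂ ε v x := by
  have hint : ∀ {φ : EuclideanSpace ℝ d → ℝ}, IsRadialBump φ →
      Integrable (fun ξ : EuclideanSpace ℝ d => FluidPDE.mollifierScale ε φ ξ •
        (v (x + FunctionSpaces.Torus.proj ξ) -
          ⟪v (x + FunctionSpaces.Torus.proj ξ), ‖ξ‖⁻¹ • ξ⟫ • (‖ξ‖⁻¹ • ξ))) volume := by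
    intro φ hφ
    obtain ⟨hkc, R, -, hks, -⟩ := kernel_facts hφ hε
    refine integrable_kernel_smul_dirMap (Φ := fun o w => w - ⟪w, o⟫ • o) hkc hks (by fun_prop) (C := 2)
      (fun o w ho => ?_) hv x
    have h1 : ‖⟪w, o⟫ • o‖ ≤ ‖w‖ := by
      rw [norm_smul, Real.norm_eq_abs]
      calc |⟪w, o⟫| * ‖o‖ ≤ (‖w‖ * ‖o‖) * ‖o‖ := by gcongr; exact abs_real_inner_le_norm _ _
        _ ≤ (‖w‖ * 1) * 1 := by gcongr
        _ = ‖w‖ := by ring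
    calc ‖w - ⟪w, o⟫ • o‖ ≤ ‖w‖ + ‖⟪w, o⟫ • o‖ := norm_sub_le _ _
      _ ≤ ‖w‖ + ‖w‖ := by gcongr
      _ = 2 * ‖w‖ := by ring
  unfold eyinkVelocityT
  rw [mollifierScale_add, ← integral_add (hint hφ₁) (hint hφ₂)]
  exact integral_congr_ae (ae_of_all _ fun ξ => by simp only [add_smul])

/-- **Additivity of `(u_T·u_T)^ε` in the profile** at an `L²` slice. [folklore] -/
theorem eyinkEnergyT_add (hφ₁ : IsRadialBump φ₁) (hφ₂ : IsRadialBump φ₂) (hε : 0 < ε)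
    {v : UnitAddTorus d → EuclideanSpace ℝ d} (hv : MemLp v 2 volume) (x : UnitAddTorus d) :
    eyinkEnergyT (fun ξ => φ₁ ξ + φ₂ ξ) ε v x = eyinkEnergyT φ₁ ε v x + eyinkEnergyT φ₂ ε v x := by
  have hv1 : Integrable v volume := hv.integrable one_le_two
  have hint : ∀ {φ : EuclideanSpace ℝ d → ℝ}, IsRadialBump φ →
      Integrable (fun ξ : EuclideanSpace ℝ d => FluidPDE.mollifierScale ε φ ξ *
        ‖v (x + FunctionSpaces.Torus.proj ξ) -
          ⟪v (x + FunctionSpaces.Torus.proj ξ), ‖ξ‖⁻¹ • ξ⟫ • (‖ξ‖⁻¹ • ξ)‖ ^ 2) volume := by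
    intro φ hφ
    obtain ⟨hkc, R, -, hks, -⟩ := kernel_facts hφ hε
    have h2 : Integrable (fun y => ‖v y‖ ^ 2) volume := hv.integrable_norm_pow two_ne_zero
    have hdom : Integrable (fun ξ : EuclideanSpace ℝ d => FluidPDE.mollifierScale ε φ ξ • ‖v (x + FunctionSpaces.Torus.proj ξ)‖ ^ 2)
        volume := integrable_smul_translate_proj hkc hks h2 x
    have hvm : AEStronglyMeasurable (fun ξ : EuclideanSpace ℝ d => v (x + FunctionSpaces.Torus.proj ξ)) volume :=
      (hv1.comp_add_left x).aestronglyMeasurable.comp_quasiMeasurePreserving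
        FunctionSpaces.Torus.quasiMeasurePreserving_proj
    have hmeas : AEStronglyMeasurable (fun ξ : EuclideanSpace ℝ d => FluidPDE.mollifierScale ε φ ξ *
        ‖v (x + FunctionSpaces.Torus.proj ξ) -
          ⟪v (x + FunctionSpaces.Torus.proj ξ), ‖ξ‖⁻¹ • ξ⟫ • (‖ξ‖⁻¹ • ξ)‖ ^ 2) volume := by
      refine hkc.aestronglyMeasurable.mul ?_
      have hc : Continuous (uncurry fun (o w : EuclideanSpace ℝ d) => w - ⟪w, o⟫ • o) := by fun_prop
      exact (hc.comp_aestronglyMeasurable (measurable_unitDir.aestronglyMeasurable.prodMk hvm)).norm.pow 2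
    refine (hdom.norm.const_mul 4).mono' hmeas (ae_of_all _ fun ξ => ?_)
    rw [norm_mul, norm_pow, norm_norm, norm_smul]
    have hP : ‖v (x + FunctionSpaces.Torus.proj ξ) - ⟪v (x + FunctionSpaces.Torus.proj ξ), ‖ξ‖⁻¹ • ξ⟫ • (‖ξ‖⁻¹ • ξ)‖ ≤
        2 * ‖v (x + FunctionSpaces.Torus.proj ξ)‖ := by
      have h := norm_projT_unit_le ξ (v (x + FunctionSpaces.Torus.proj ξ))
      rwa [projT_apply, real_inner_comm] at h
    calc ‖FluidPDE.mollifierScale ε φ ξ‖ *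
          ‖v (x + FunctionSpaces.Torus.proj ξ) - ⟪v (x + FunctionSpaces.Torus.proj ξ), ‖ξ‖⁻¹ • ξ⟫ • (‖ξ‖⁻¹ • ξ)‖ ^ 2
        ≤ ‖FluidPDE.mollifierScale ε φ ξ‖ * (2 * ‖v (x + FunctionSpaces.Torus.proj ξ)‖) ^ 2 := by gcongr
      _ = 4 * (‖FluidPDE.mollifierScale ε φ ξ‖ * ‖‖v (x + FunctionSpaces.Torus.proj ξ)‖ ^ 2‖) := by
          rw [norm_pow, norm_norm]; ring
  unfold eyinkEnergyT
  rw [mollifierScale_add, ← integral_add (hint hφ₁) (hint hφ₂)]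
  exact integral_congr_ae (ae_of_all _ fun ξ => by simp only [add_mul])

/-- **Additivity of `((u_T·u_T)u)^ε` in the profile** at an `L³` slice. [folklore] -/
theorem eyinkEnergyFluxT_add (hφ₁ : IsRadialBump φ₁) (hφ₂ : IsRadialBump φ₂) (hε : 0 < ε)
    {v : UnitAddTorus d → EuclideanSpace ℝ d} (hv : MemLp v 3 volume) (x : UnitAddTorus d) :
    eyinkEnergyFluxT (fun ξ => φ₁ ξ + φ₂ ξ) ε v x = eyinkEnergyFluxT φ₁ ε v x + eyinkEnergyFluxT φ₂ ε v x := by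
  have hv1 : Integrable v volume := hv.integrable (by norm_num)
  have hint : ∀ {φ : EuclideanSpace ℝ d → ℝ}, IsRadialBump φ →
      Integrable (fun ξ : EuclideanSpace ℝ d => (FluidPDE.mollifierScale ε φ ξ *
        ‖v (x + FunctionSpaces.Torus.proj ξ) -
          ⟪v (x + FunctionSpaces.Torus.proj ξ), ‖ξ‖⁻¹ • ξ⟫ • (‖ξ‖⁻¹ • ξ)‖ ^ 2) • v (x + FunctionSpaces.Torus.proj ξ)) volume := by
    intro φ hφ
    obtain ⟨hkc, R, -, hks, -⟩ := kernel_facts hφ hε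
    have h3 : Integrable (fun y => ‖v y‖ ^ 3) volume := hv.integrable_norm_pow three_ne_zero
    have hdom : Integrable (fun ξ : EuclideanSpace ℝ d => FluidPDE.mollifierScale ε φ ξ • ‖v (x + FunctionSpaces.Torus.proj ξ)‖ ^ 3)
        volume := integrable_smul_translate_proj hkc hks h3 x
    have hvm : AEStronglyMeasurable (fun ξ : EuclideanSpace ℝ d => v (x + FunctionSpaces.Torus.proj ξ)) volume :=
      (hv1.comp_add_left x).aestronglyMeasurable.comp_quasiMeasurePreserving
        FunctionSpaces.Torus.quasiMeasurePreserving_proj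
    have hmeas : AEStronglyMeasurable (fun ξ : EuclideanSpace ℝ d => (FluidPDE.mollifierScale ε φ ξ *
        ‖v (x + FunctionSpaces.Torus.proj ξ) -
          ⟪v (x + FunctionSpaces.Torus.proj ξ), ‖ξ‖⁻¹ • ξ⟫ • (‖ξ‖⁻¹ • ξ)‖ ^ 2) • v (x + FunctionSpaces.Torus.proj ξ)) volume := by
      refine (hkc.aestronglyMeasurable.mul ?_).smul hvm
      have hc : Continuous (uncurry fun (o w : EuclideanSpace ℝ d) => w - ⟪w, o⟫ • o) := by fun_prop
      exact (hc.comp_aestronglyMeasurable (measurable_unitDir.aestronglyMeasurable.prodMk hvm)).norm.pow 2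
    refine (hdom.norm.const_mul 4).mono' hmeas (ae_of_all _ fun ξ => ?_)
    rw [norm_smul, norm_mul, norm_pow, norm_norm, norm_smul]
    have hP : ‖v (x + FunctionSpaces.Torus.proj ξ) - ⟪v (x + FunctionSpaces.Torus.proj ξ), ‖ξ‖⁻¹ • ξ⟫ • (‖ξ‖⁻¹ • ξ)‖ ≤
        2 * ‖v (x + FunctionSpaces.Torus.proj ξ)‖ := by
      have h := norm_projT_unit_le ξ (v (x + FunctionSpaces.Torus.proj ξ))
      rwa [projT_apply, real_inner_comm] at h
    calc ‖FluidPDE.mollifierScale ε φ ξ‖ *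
          ‖v (x + FunctionSpaces.Torus.proj ξ) - ⟪v (x + FunctionSpaces.Torus.proj ξ), ‖ξ‖⁻¹ • ξ⟫ • (‖ξ‖⁻¹ • ξ)‖ ^ 2 *
          ‖v (x + FunctionSpaces.Torus.proj ξ)‖
        ≤ ‖FluidPDE.mollifierScale ε φ ξ‖ * (2 * ‖v (x + FunctionSpaces.Torus.proj ξ)‖) ^ 2 *
          ‖v (x + FunctionSpaces.Torus.proj ξ)‖ := by gcongr
      _ = 4 * (‖FluidPDE.mollifierScale ε φ ξ‖ * ‖‖v (x + FunctionSpaces.Torus.proj ξ)‖ ^ 3‖) := by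
          rw [norm_pow, norm_norm]; ring
  unfold eyinkEnergyFluxT
  rw [mollifierScale_add, ← integral_add (hint hφ₁) (hint hφ₂)]
  exact integral_congr_ae (ae_of_all _ fun ξ => by simp only [add_mul, add_smul])

omit [DecidableEq d] in
/-- Integrability of the transverse-kernel integrand `s ↦ s⁻¹ k(sξ)` on `(1, ∞)` for a continuous `k`
vanishing off a ball and `ξ ≠ 0` (the integrand is continuous and vanishes for large `s`). [folklore] -/
theorem integrableOn_inv_mul_comp_smul {k : EuclideanSpace ℝ d → ℝ} (hk : Continuous k) {R : ℝ}
    (hR : ∀ η : EuclideanSpace ℝ d, R ≤ ‖η‖ → k η = 0) {ξ : EuclideanSpace ℝ d} (hξ : ξ ≠ 0) :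
    IntegrableOn (fun s : ℝ => s⁻¹ * k (s • ξ)) (Ioi 1) volume := by
  have hn : 0 < ‖ξ‖ := norm_pos_iff.2 hξ
  set M : ℝ := max 1 (|R| / ‖ξ‖) + 1 with hM
  have hM1 : (1 : ℝ) ≤ M := by
    have := le_max_left (1 : ℝ) (|R| / ‖ξ‖); linarith
  have hvan : ∀ s, M ≤ s → s⁻¹ * k (s • ξ) = 0 := by
    intro s hs
    have hs0 : 0 < s := by linarith
    rw [hR _ ?_, mul_zero]
    rw [norm_smul, Real.norm_eq_abs, abs_of_pos hs0]
    have h1 : |R| / ‖ξ‖ < s := by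
      have := le_max_right (1 : ℝ) (|R| / ‖ξ‖); linarith
    rw [div_lt_iff₀ hn] at h1
    exact (le_abs_self R).trans h1.le
  have hc : ContinuousOn (fun s : ℝ => s⁻¹ * k (s • ξ)) (Icc 1 M) := by
    refine ContinuousOn.mul (continuousOn_inv₀.mono ?_) (hk.comp (continuous_id.smul continuous_const)).continuousOn
    intro s hs
    exact ne_of_gt (lt_of_lt_of_le one_pos hs.1)
  have h1 : IntegrableOn (fun s : ℝ => s⁻¹ * k (s • ξ)) (Ioc 1 M) volume :=
    (hc.integrableOn_Icc).mono_set Ioc_subset_Icc_self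
  have h2 : IntegrableOn (fun s : ℝ => s⁻¹ * k (s • ξ)) (Ioi M) volume :=
    (integrableOn_zero (s := Ioi M)).congr_fun (fun s hs => (hvan s (le_of_lt hs)).symm) measurableSet_Ioi
  have := h1.union h2
  rwa [Ioc_union_Ioi_eq_Ioi hM1] at this

omit [DecidableEq d] in
/-- **Additivity of Eyink's transverse kernel `φ_T` in the profile, off the origin.** [folklore] -/
theorem eyinkTransverseKernel_add {k₁ k₂ : EuclideanSpace ℝ d → ℝ} (h₁ : Continuous k₁) (h₂ : Continuous k₂) {R : ℝ}
    (hR₁ : ∀ η : EuclideanSpace ℝ d, R ≤ ‖η‖ → k₁ η = 0) (hR₂ : ∀ η : EuclideanSpace ℝ d, R ≤ ‖η‖ → k₂ η = 0)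
    {ξ : EuclideanSpace ℝ d} (hξ : ξ ≠ 0) :
    eyinkTransverseKernel d (fun η => k₁ η + k₂ η) ξ = eyinkTransverseKernel d k₁ ξ + eyinkTransverseKernel d k₂ ξ := by
  simp only [eyinkTransverseKernel_apply]
  rw [← mul_add, ← integral_add (integrableOn_inv_mul_comp_smul h₁ hR₁ hξ) (integrableOn_inv_mul_comp_smul h₂ hR₂ hξ)]
  congr 1
  exact setIntegral_congr_fun measurableSet_Ioi fun s _ => by ring

end Objects

/-! ## Additivity of the balance pairing in the profile -/

section Balance

variable [DecidableEq d] [Nonempty d] {T ε : ℝ} {u : ℝ → UnitAddTorus d → EuclideanSpace ℝ d}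
  {p : ℝ → UnitAddTorus d → ℝ} {ψ : ℝ → UnitAddTorus d → ℝ} {φ φ₁ φ₂ : EuclideanSpace ℝ d → ℝ}

omit [DecidableEq d] in
/-- **Additivity of `p_T^ε` in the profile** at a point where both `ξ`-integrands are integrable. [folklore] -/
theorem eyinkPressureT_add_of_integrable (hφ₁ : IsRadialBump φ₁) (hφ₂ : IsRadialBump φ₂) (hε : 0 < ε)
    {q : UnitAddTorus d → ℝ} {x : UnitAddTorus d}
    (h₁ : Integrable (fun ξ => eyinkTransverseKernel d (FluidPDE.mollifierScale ε φ₁) ξ * q (x + FunctionSpaces.Torus.proj ξ)) volume)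
    (h₂ : Integrable (fun ξ => eyinkTransverseKernel d (FluidPDE.mollifierScale ε φ₂) ξ * q (x + FunctionSpaces.Torus.proj ξ)) volume) :
    eyinkPressureT (fun ξ => φ₁ ξ + φ₂ ξ) ε q x = eyinkPressureT φ₁ ε q x + eyinkPressureT φ₂ ε q x := by
  obtain ⟨hk₁c, R₁, -, -, hR₁⟩ := kernel_facts hφ₁ hε
  obtain ⟨hk₂c, R₂, -, -, hR₂⟩ := kernel_facts hφ₂ hε
  have hR₁' : ∀ η : EuclideanSpace ℝ d, max R₁ R₂ ≤ ‖η‖ → FluidPDE.mollifierScale ε φ₁ η = 0 :=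
    fun η hη => hR₁ η ((le_max_left _ _).trans hη)
  have hR₂' : ∀ η : EuclideanSpace ℝ d, max R₁ R₂ ≤ ‖η‖ → FluidPDE.mollifierScale ε φ₂ η = 0 :=
    fun η hη => hR₂ η ((le_max_right _ _).trans hη)
  have h0ae : ∀ᵐ ξ : EuclideanSpace ℝ d ∂volume, ξ ≠ 0 := by
    have h : ({(0 : EuclideanSpace ℝ d)}ᶜ : Set (EuclideanSpace ℝ d)) ∈ ae (volume : Measure (EuclideanSpace ℝ d)) :=
      compl_mem_ae_iff.2 (measure_singleton 0)
    filter_upwards [h] with ξ hξ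
    simpa using hξ
  unfold eyinkPressureT
  rw [mollifierScale_add, ← integral_add h₁ h₂]
  refine integral_congr_ae ?_
  filter_upwards [h0ae] with ξ hξ
  rw [eyinkTransverseKernel_add hk₁c hk₂c hR₁' hR₂' hξ, add_mul]

omit [DecidableEq d] in
/-- **The balance pairing as one product integral** (`eyink_piecesT_integrable`, Fubini): the total
integrand is integrable on `(0,T) × T^d` and `𝓔_T^{ε,φ}(ψ)` is its integral. [folklore] -/
theorem eyinkBalanceT_eq_integral_tot
    (hum : AEStronglyMeasurable (FunctionSpaces.Torus.stLift u) (volume.restrict (Ioo 0 T ×ˢ univ)))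
    (hu3 : ∫⁻ t in Ioo 0 T, ∫⁻ x, ‖u t x‖ₑ ^ 3 < ⊤)
    (hpm : AEStronglyMeasurable (FunctionSpaces.Torus.stLift p) (volume.restrict (Ioo 0 T ×ˢ univ)))
    (hp32 : ∫⁻ t in Ioo 0 T, ∫⁻ x, ‖p t x‖ₑ ^ (3 / 2 : ℝ) < ⊤)
    (hφ : IsRadialBump φ) (hφ0 : ∀ ξ, 0 ≤ φ ξ) (hφ1 : ∀ ξ, 1 < ‖ξ‖ → φ ξ = 0) (hε : 0 < ε)
    (hψ : FunctionSpaces.Torus.IsSpaceTimeTestIoo T ψ) :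
    Integrable (fun q : ℝ × UnitAddTorus d =>
      2 * (⟪u q.1 q.2, eyinkVelocityT φ ε (u q.1) q.2⟫ * FunctionSpaces.Torus.timeDeriv ψ q.1 q.2) +
      2 * (⟪u q.1 q.2, eyinkVelocityT φ ε (u q.1) q.2⟫ * ⟪u q.1 q.2, FunctionSpaces.Torus.gradient (ψ q.1) q.2⟫) +
      ⟪eyinkEnergyFluxT φ ε (u q.1) q.2, FunctionSpaces.Torus.gradient (ψ q.1) q.2⟫ -
      eyinkEnergyT φ ε (u q.1) q.2 * ⟪u q.1 q.2, FunctionSpaces.Torus.gradient (ψ q.1) q.2⟫ +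
      2 * (p q.1 q.2 * ⟪eyinkVelocityT φ ε (u q.1) q.2, FunctionSpaces.Torus.gradient (ψ q.1) q.2⟫) +
      2 * (eyinkPressureT φ ε (p q.1) q.2 * ⟪u q.1 q.2, FunctionSpaces.Torus.gradient (ψ q.1) q.2⟫)) (stMeasure d T) ∧
    eyinkBalanceT T u p φ ε ψ = ∫ q, (
      2 * (⟪u q.1 q.2, eyinkVelocityT φ ε (u q.1) q.2⟫ * FunctionSpaces.Torus.timeDeriv ψ q.1 q.2) +
      2 * (⟪u q.1 q.2, eyinkVelocityT φ ε (u q.1) q.2⟫ * ⟪u q.1 q.2, FunctionSpaces.Torus.gradient (ψ q.1) q.2⟫) +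
      ⟪eyinkEnergyFluxT φ ε (u q.1) q.2, FunctionSpaces.Torus.gradient (ψ q.1) q.2⟫ -
      eyinkEnergyT φ ε (u q.1) q.2 * ⟪u q.1 q.2, FunctionSpaces.Torus.gradient (ψ q.1) q.2⟫ +
      2 * (p q.1 q.2 * ⟪eyinkVelocityT φ ε (u q.1) q.2, FunctionSpaces.Torus.gradient (ψ q.1) q.2⟫) +
      2 * (eyinkPressureT φ ε (p q.1) q.2 * ⟪u q.1 q.2, FunctionSpaces.Torus.gradient (ψ q.1) q.2⟫)) ∂(stMeasure d T) := by
  obtain ⟨hA, hB, hC, hD, hE, hF⟩ := eyink_piecesT_integrable hum hu3 hpm hp32 hφ hφ0 hφ1 hε hψ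
  have hTot : Integrable (fun q : ℝ × UnitAddTorus d =>
      2 * (⟪u q.1 q.2, eyinkVelocityT φ ε (u q.1) q.2⟫ * FunctionSpaces.Torus.timeDeriv ψ q.1 q.2) +
      2 * (⟪u q.1 q.2, eyinkVelocityT φ ε (u q.1) q.2⟫ * ⟪u q.1 q.2, FunctionSpaces.Torus.gradient (ψ q.1) q.2⟫) +
      ⟪eyinkEnergyFluxT φ ε (u q.1) q.2, FunctionSpaces.Torus.gradient (ψ q.1) q.2⟫ -
      eyinkEnergyT φ ε (u q.1) q.2 * ⟪u q.1 q.2, FunctionSpaces.Torus.gradient (ψ q.1) q.2⟫ +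
      2 * (p q.1 q.2 * ⟪eyinkVelocityT φ ε (u q.1) q.2, FunctionSpaces.Torus.gradient (ψ q.1) q.2⟫) +
      2 * (eyinkPressureT φ ε (p q.1) q.2 * ⟪u q.1 q.2, FunctionSpaces.Torus.gradient (ψ q.1) q.2⟫)) (stMeasure d T) :=
    (((((hA.const_mul 2).add (hB.const_mul 2)).add hC).sub hD).add (hE.const_mul 2)).add (hF.const_mul 2)
  refine ⟨hTot, ?_⟩
  rw [integral_prod _ hTot, eyinkBalanceT]
  refine setIntegral_congr_fun measurableSet_Ioo fun t _ => ?_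
  refine integral_congr_ae (ae_of_all _ fun x => ?_)
  simp only
  ring

/-- **Additivity of the balance pairing `𝓔_T^{ε,φ}(ψ)` in the profile** (both nonnegative radial bumps
supported in the unit ball): the objects `u_T^ε, (u_T·u_T)^ε, ((u_T·u_T)u)^ε, p_T^ε` are additive in
`φ` at a.e. `(t,x)` (integrable slices), and each total integrand is integrable. [folklore] -/
theorem eyinkBalanceT_add
    (hum : AEStronglyMeasurable (FunctionSpaces.Torus.stLift u) (volume.restrict (Ioo 0 T ×ˢ univ)))
    (hu3 : ∫⁻ t in Ioo 0 T, ∫⁻ x, ‖u t x‖ₑ ^ 3 < ⊤)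
    (hpm : AEStronglyMeasurable (FunctionSpaces.Torus.stLift p) (volume.restrict (Ioo 0 T ×ˢ univ)))
    (hp32 : ∫⁻ t in Ioo 0 T, ∫⁻ x, ‖p t x‖ₑ ^ (3 / 2 : ℝ) < ⊤)
    (hφ₁ : IsRadialBump φ₁) (h₁0 : ∀ ξ, 0 ≤ φ₁ ξ) (h₁1 : ∀ ξ, 1 < ‖ξ‖ → φ₁ ξ = 0)
    (hφ₂ : IsRadialBump φ₂) (h₂0 : ∀ ξ, 0 ≤ φ₂ ξ) (h₂1 : ∀ ξ, 1 < ‖ξ‖ → φ₂ ξ = 0) (hε : 0 < ε)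
    (hψ : FunctionSpaces.Torus.IsSpaceTimeTestIoo T ψ) :
    eyinkBalanceT T u p (fun ξ => φ₁ ξ + φ₂ ξ) ε ψ = eyinkBalanceT T u p φ₁ ε ψ + eyinkBalanceT T u p φ₂ ε ψ := by
  set ν := stMeasure d T with hν
  have h12 : IsRadialBump fun ξ => φ₁ ξ + φ₂ ξ :=
    ⟨hφ₁.smooth.add hφ₂.smooth, hφ₁.hasCompactSupport.add hφ₂.hasCompactSupport,
      fun ξ η h => by rw [hφ₁.radial ξ η h, hφ₂.radial ξ η h]⟩
  have h120 : ∀ ξ, 0 ≤ φ₁ ξ + φ₂ ξ := fun ξ => add_nonneg (h₁0 ξ) (h₂0 ξ)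
  have h121 : ∀ ξ, 1 < ‖ξ‖ → φ₁ ξ + φ₂ ξ = 0 := fun ξ hξ => by rw [h₁1 ξ hξ, h₂1 ξ hξ, add_zero]
  obtain ⟨hT12, e12⟩ := eyinkBalanceT_eq_integral_tot hum hu3 hpm hp32 h12 h120 h121 hε hψ
  obtain ⟨hT1, e1⟩ := eyinkBalanceT_eq_integral_tot hum hu3 hpm hp32 hφ₁ h₁0 h₁1 hε hψ
  obtain ⟨hT2, e2⟩ := eyinkBalanceT_eq_integral_tot hum hu3 hpm hp32 hφ₂ h₂0 h₂1 hε hψ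
  rw [e12, e1, e2, ← integral_add hT1 hT2]
  refine integral_congr_ae ?_
  -- slices
  have hu : AEStronglyMeasurable (uncurry u) ν := aestronglyMeasurable_uncurry_prod_of_stLift_Ioo hum
  have hp : AEStronglyMeasurable (uncurry p) ν := aestronglyMeasurable_uncurry_prod_of_stLift_Ioo' hpm
  have hp32' : ∫⁻ q, ‖uncurry p q‖ₑ ^ (3 / 2 : ℝ) ∂ν < ⊤ := by
    have e := lintegral_Ioo_lintegral_eq_lintegral_prod (T := T) (g := fun t x => ‖p t x‖ₑ ^ (3 / 2 : ℝ)) (hp.enorm.pow_const _)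
    rw [e] at hp32; exact hp32
  have hp1 : ∫⁻ q, ‖uncurry p q‖ₑ ∂ν < ⊤ := by
    have h := lintegral_enorm_rpow_lt_top_of_le hp (by norm_num : (1 : ℝ) ≤ 3 / 2) hp32' one_pos (by norm_num : (1 : ℝ) ≤ 3 / 2)
    simpa only [ENNReal.rpow_one] using h
  have hsu : ∀ᵐ q ∂ν, MemLp (u q.1) 3 volume :=
    (Measure.quasiMeasurePreserving_fst (μ := volume.restrict (Ioo 0 T)) (ν := (volume : Measure (UnitAddTorus d)))).ae
      (ae_memLp_three_of_stLift hum hu3)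
  have hsp : ∀ᵐ q ∂ν, Integrable (p q.1) volume :=
    (Measure.quasiMeasurePreserving_fst (μ := volume.restrict (Ioo 0 T)) (ν := (volume : Measure (UnitAddTorus d)))).ae
      (ae_integrable_of_stLift_threeHalves hpm hp32)
  -- a.e. `ξ`-integrability of the pressure integrands
  obtain ⟨-, -, -, hkT₁, -⟩ := transverse_kernels_facts hφ₁ h₁0 h₁1 hε
  obtain ⟨-, -, -, hkT₂, -⟩ := transverse_kernels_facts hφ₂ h₂0 h₂1 hε
  obtain ⟨-, haeP₁⟩ := ae_integrable_kernel_mul_translate (T := T) hkT₁ hp hp1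
  obtain ⟨-, haeP₂⟩ := ae_integrable_kernel_mul_translate (T := T) hkT₂ hp hp1
  have hPint : ∀ {k : EuclideanSpace ℝ d → ℝ}, Integrable k volume → ∀ {q : ℝ × UnitAddTorus d},
      Integrable (p q.1) volume →
      Integrable (fun ξ : EuclideanSpace ℝ d => ‖k ξ‖ * ‖uncurry p (stTranslate d ξ q)‖) volume →
      Integrable (fun ξ : EuclideanSpace ℝ d => k ξ * p q.1 (q.2 + FunctionSpaces.Torus.proj ξ)) volume := by
    intro k hk q hpq hI
    have hm : AEStronglyMeasurable (fun ξ : EuclideanSpace ℝ d => k ξ * p q.1 (q.2 + FunctionSpaces.Torus.proj ξ)) volume :=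
      hk.aestronglyMeasurable.mul ((hpq.comp_add_left q.2).aestronglyMeasurable.comp_quasiMeasurePreserving
        FunctionSpaces.Torus.quasiMeasurePreserving_proj)
    refine hI.mono' hm (ae_of_all _ fun ξ => ?_)
    rw [norm_mul]
    rfl
  filter_upwards [hsu, hsp, haeP₁, haeP₂] with q hq hpq hI₁ hI₂
  have hq1 : Integrable (u q.1) volume := hq.integrable (by norm_num)
  have hq2 : MemLp (u q.1) 2 volume := hq.mono_exponent (by norm_num)
  rw [eyinkVelocityT_add hφ₁ hφ₂ hε hq1, eyinkEnergyT_add hφ₁ hφ₂ hε hq2, eyinkEnergyFluxT_add hφ₁ hφ₂ hε hq,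
    eyinkPressureT_add_of_integrable hφ₁ hφ₂ hε (hPint hkT₁ hpq hI₁) (hPint hkT₂ hpq hI₂)]
  simp only [inner_add_left, inner_add_right]
  ring

end Balance

/-! ## The balance pairing is controlled by the mass of the profile -/

section MassBound

variable [DecidableEq d] {T : ℝ} {u : ℝ → UnitAddTorus d → EuclideanSpace ℝ d}
  {p : ℝ → UnitAddTorus d → ℝ} {ψ : ℝ → UnitAddTorus d → ℝ}

omit [DecidableEq d] in
/-- **`|𝓔_T^{ε,φ}(ψ)| ≤ C ∫φ`** with `C` depending only on the data `u, p, ψ, T, d` (`d` nonempty): for every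
nonnegative radial bump `φ` supported in the unit ball and every `ε > 0`. Each of the six pieces is a
kernel pairing `∭ k(ξ) Ξ(t,x,ξ)` bounded by the Type I–IV estimates of `EyinkBalanceLimits` (crude
translation moduli `2‖u‖₃`, `2‖p‖_{3/2}`): `|∭kΞ| ≤ |λ|·|X| + E ∫|k|` with `λ ∝ ∫k`, and
`∫|φ^ε| = ∫φ^ε = ∫φ`, `∫|φ_T^ε| = ((d−1)/d)∫φ`. [folklore] -/
theorem exists_abs_eyinkBalanceT_le
    (hum : AEStronglyMeasurable (FunctionSpaces.Torus.stLift u) (volume.restrict (Ioo 0 T ×ˢ univ)))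
    (hu3 : ∫⁻ t in Ioo 0 T, ∫⁻ x, ‖u t x‖ₑ ^ 3 < ⊤)
    (hpm : AEStronglyMeasurable (FunctionSpaces.Torus.stLift p) (volume.restrict (Ioo 0 T ×ˢ univ)))
    (hp32 : ∫⁻ t in Ioo 0 T, ∫⁻ x, ‖p t x‖ₑ ^ (3 / 2 : ℝ) < ⊤)
    (hψ : FunctionSpaces.Torus.IsSpaceTimeTestIoo T ψ) [Nonempty d] :
    ∃ C : ℝ, 0 ≤ C ∧ ∀ ⦃φ : EuclideanSpace ℝ d → ℝ⦄ ⦃ε : ℝ⦄, IsRadialBump φ → (∀ ξ, 0 ≤ φ ξ) →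
      (∀ ξ, 1 < ‖ξ‖ → φ ξ = 0) → 0 < ε → |eyinkBalanceT T u p φ ε ψ| ≤ C * ∫ ξ, φ ξ := by
  -- product forms of the data
  have hu : AEStronglyMeasurable (uncurry u) (stMeasure d T) := aestronglyMeasurable_uncurry_prod_of_stLift_Ioo hum
  have hu3' : ∫⁻ q, ‖uncurry u q‖ₑ ^ (3 : ℝ) ∂(stMeasure d T) < ⊤ := by
    have h := lintegral_prod_enorm_pow_three_lt_top hu hu3
    have e : ∫⁻ q, ‖uncurry u q‖ₑ ^ 3 ∂(stMeasure d T) = ∫⁻ q, ‖uncurry u q‖ₑ ^ (3 : ℝ) ∂(stMeasure d T) :=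
      lintegral_congr fun q => ENNReal.pow_three_eq_rpow _
    rw [← e]; exact h
  have hu1 : ∫⁻ q, ‖uncurry u q‖ₑ ∂(stMeasure d T) < ⊤ := by
    have h := lintegral_enorm_rpow_lt_top_of_le hu (by norm_num) hu3' one_pos (by norm_num : (1 : ℝ) ≤ 3)
    simpa only [ENNReal.rpow_one] using h
  have hp : AEStronglyMeasurable (uncurry p) (stMeasure d T) := aestronglyMeasurable_uncurry_prod_of_stLift_Ioo' hpm
  have hp32' : ∫⁻ q, ‖uncurry p q‖ₑ ^ (3 / 2 : ℝ) ∂(stMeasure d T) < ⊤ := by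
    have e := lintegral_Ioo_lintegral_eq_lintegral_prod (T := T) (g := fun t x => ‖p t x‖ₑ ^ (3 / 2 : ℝ))
      (hp.enorm.pow_const _)
    rw [e] at hp32
    exact hp32
  -- test data
  obtain ⟨Cψ, hCψ, hθb, hHb, hθm, hHm⟩ := hψ.testData_bound
  set θ : ℝ × UnitAddTorus d → ℝ := fun q => FunctionSpaces.Torus.timeDeriv ψ q.1 q.2 with hθdef
  set Hψ : ℝ × UnitAddTorus d → EuclideanSpace ℝ d := fun q => FunctionSpaces.Torus.gradient (ψ q.1) q.2 with hHdef
  have hθm' : AEStronglyMeasurable θ (stMeasure d T) := hθm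
  have hHm' : AEStronglyMeasurable Hψ (stMeasure d T) := hHm
  -- the weight `g = ⟪u, ∇ψ⟫ ∈ L³`
  set g : ℝ × UnitAddTorus d → ℝ := fun q => ⟪uncurry u q, Hψ q⟫ with hgdef
  have hgm : AEStronglyMeasurable g (stMeasure d T) := hu.inner hHm'
  have hgb : ∀ q, |g q| ≤ Cψ * ‖uncurry u q‖ := fun q => by
    calc |⟪uncurry u q, Hψ q⟫| ≤ ‖uncurry u q‖ * ‖Hψ q‖ := abs_real_inner_le_norm _ _
      _ ≤ ‖uncurry u q‖ * Cψ := by gcongr; exact hHb q.1 q.2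
      _ = Cψ * ‖uncurry u q‖ := mul_comm _ _
  have hg3 : ∫⁻ q, ‖g q‖ₑ ^ (3 : ℝ) ∂(stMeasure d T) < ⊤ := lintegral_enorm_rpow_three_lt_top_of_le hCψ hgb hu3'
  -- the three Type-I weights in `L^{3/2}`
  have hu32 : ∫⁻ q, ‖uncurry u q‖ₑ ^ (3 / 2 : ℝ) ∂(stMeasure d T) < ⊤ :=
    lintegral_enorm_rpow_lt_top_of_le hu (by norm_num) hu3' (by norm_num) (by norm_num)
  set c₁ : ℝ × UnitAddTorus d → EuclideanSpace ℝ d := fun q => θ q • uncurry u q with hc₁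
  set c₂ : ℝ × UnitAddTorus d → EuclideanSpace ℝ d := fun q => g q • uncurry u q with hc₂
  set c₃ : ℝ × UnitAddTorus d → EuclideanSpace ℝ d := fun q => uncurry p q • Hψ q with hc₃
  have hc₁m : AEStronglyMeasurable c₁ (stMeasure d T) := hθm'.smul hu
  have hc₂m : AEStronglyMeasurable c₂ (stMeasure d T) := hgm.smul hu
  have hc₃m : AEStronglyMeasurable c₃ (stMeasure d T) := hp.smul hHm'
  have hc₁32 : ∫⁻ q, ‖c₁ q‖ₑ ^ (3 / 2 : ℝ) ∂(stMeasure d T) < ⊤ := by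
    refine lintegral_enorm_rpow_lt_top_of_norm_le hCψ (by norm_num) (fun q => ?_) hu32
    rw [hc₁, norm_smul, Real.norm_eq_abs]
    gcongr
    exact hθb q.1 q.2
  have hc₂32 : ∫⁻ q, ‖c₂ q‖ₑ ^ (3 / 2 : ℝ) ∂(stMeasure d T) < ⊤ := by
    have hsq : ∫⁻ q, ‖‖uncurry u q‖ ^ 2‖ₑ ^ (3 / 2 : ℝ) ∂(stMeasure d T) < ⊤ := by
      have e : ∀ q, ‖‖uncurry u q‖ ^ 2‖ₑ ^ (3 / 2 : ℝ) = ‖uncurry u q‖ₑ ^ (3 : ℝ) := fun q => by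
        rw [enorm_norm_pow, ENNReal.sq_rpow_three_halves]
      simp only [e]; exact hu3'
    refine lintegral_enorm_rpow_lt_top_of_norm_le hCψ (by norm_num) (fun q => ?_) hsq
    show ‖g q • uncurry u q‖ ≤ Cψ * ‖‖uncurry u q‖ ^ 2‖
    rw [norm_smul, Real.norm_eq_abs, Real.norm_of_nonneg (sq_nonneg _), sq, ← mul_assoc]
    gcongr
    exact hgb q
  have hc₃32 : ∫⁻ q, ‖c₃ q‖ₑ ^ (3 / 2 : ℝ) ∂(stMeasure d T) < ⊤ := by
    refine lintegral_enorm_rpow_lt_top_of_norm_le hCψ (by norm_num) (fun q => ?_) hp32'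
    rw [hc₃, norm_smul, mul_comm]
    gcongr
    exact hHb q.1 q.2
  -- crude moduli
  set m : ℝ≥0∞ := 2 * (∫⁻ q, ‖uncurry u q‖ₑ ^ (3 : ℝ) ∂(stMeasure d T)) ^ (1 / 3 : ℝ) with hmdef
  have hm : m ≠ ⊤ := ENNReal.mul_ne_top (by simp) (ENNReal.rpow_ne_top_of_nonneg (by norm_num) hu3'.ne)
  have hmod : ∀ {ε : ℝ} (ξ : EuclideanSpace ℝ d), ‖ξ‖ ≤ ε →
      (∫⁻ q, ‖uncurry u (stTranslate d ξ q) - uncurry u q‖ₑ ^ (3 : ℝ) ∂(stMeasure d T)) ^ (1 / 3 : ℝ) ≤ m := fun ξ _ =>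
    lintegral_translate_sub_rpow_le hu (by norm_num) ξ
  set mP : ℝ≥0∞ := 2 * (∫⁻ q, ‖uncurry p q‖ₑ ^ (3 / 2 : ℝ) ∂(stMeasure d T)) ^ (2 / 3 : ℝ) with hmPdef
  have hmP : mP ≠ ⊤ := ENNReal.mul_ne_top (by simp) (ENNReal.rpow_ne_top_of_nonneg (by norm_num) hp32'.ne)
  have hmodP : ∀ {ε : ℝ} (ξ : EuclideanSpace ℝ d), ‖ξ‖ ≤ ε →
      (∫⁻ q, ‖uncurry p (stTranslate d ξ q) - uncurry p q‖ₑ ^ (3 / 2 : ℝ) ∂(stMeasure d T)) ^ (2 / 3 : ℝ) ≤ mP := fun ξ _ => by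
    have h := lintegral_translate_sub_rpow_le hp (by norm_num : (1 : ℝ) ≤ 3 / 2) ξ
    have e : (1 : ℝ) / (3 / 2) = 2 / 3 := by norm_num
    simpa only [e] using h
  -- the constants
  set cT : ℝ := ((Fintype.card d : ℝ) - 1) / Fintype.card d with hcTdef
  have hd1 : 1 ≤ Fintype.card d := Fintype.card_pos
  have hcT : 0 ≤ cT := by
    have h1 : (1 : ℝ) ≤ Fintype.card d := by exact_mod_cast hd1
    have : 0 ≤ (Fintype.card d : ℝ) - 1 := by linarith
    positivity
  set N3 : ℝ≥0∞ := (∫⁻ q, ‖uncurry u q‖ₑ ^ (3 : ℝ) ∂(stMeasure d T)) ^ (1 / 3 : ℝ) with hN3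
  set NG : ℝ≥0∞ := (∫⁻ q, ‖g q‖ₑ ^ (3 : ℝ) ∂(stMeasure d T)) ^ (1 / 3 : ℝ) with hNG
  set EA : ℝ := 2 * (m * (∫⁻ q, ‖c₁ q‖ₑ ^ (3 / 2 : ℝ) ∂(stMeasure d T)) ^ (2 / 3 : ℝ)).toReal with hEA
  set EB : ℝ := 2 * (m * (∫⁻ q, ‖c₂ q‖ₑ ^ (3 / 2 : ℝ) ∂(stMeasure d T)) ^ (2 / 3 : ℝ)).toReal with hEB
  set EE : ℝ := 2 * (m * (∫⁻ q, ‖c₃ q‖ₑ ^ (3 / 2 : ℝ) ∂(stMeasure d T)) ^ (2 / 3 : ℝ)).toReal with hEE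
  set EC : ℝ := 2 ^ 2 * Cψ * (4 * (m * N3 * N3).toReal) with hEC
  set ED : ℝ := 2 ^ 2 * (2 * (m * N3 * NG).toReal) with hED
  set EF : ℝ := (NG * mP).toReal with hEF
  set XA : ℝ := ∫ q, ⟪uncurry u q, c₁ q⟫ ∂(stMeasure d T) with hXA
  set XB : ℝ := ∫ q, ⟪uncurry u q, c₂ q⟫ ∂(stMeasure d T) with hXB
  set XE : ℝ := ∫ q, ⟪uncurry u q, c₃ q⟫ ∂(stMeasure d T) with hXE
  set XC : ℝ := ∫ q, ‖uncurry u q‖ ^ 2 * ⟪uncurry u q, Hψ q⟫ ∂(stMeasure d T) with hXC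
  set XF : ℝ := ∫ q, uncurry p q * g q ∂(stMeasure d T) with hXF
  refine ⟨2 * (cT * |XA| + EA) + 2 * (cT * |XB| + EB) + (cT * |XC| + EC) + (cT * |XC| + ED) +
      2 * (cT * |XE| + EE) + 2 * (cT * |XF| + cT * EF), by positivity, ?_⟩
  intro φ ε hφ hφ0 hφ1 hε
  set M : ℝ := ∫ ξ, φ ξ with hMdef
  -- kernels, projections, angular identities, masses
  obtain ⟨hk, hksupp, hkrad, hkT, hkTsupp⟩ := transverse_kernels_facts hφ hφ0 hφ1 hε
  have hk0 : ∀ ξ, 0 ≤ FluidPDE.mollifierScale ε φ ξ := fun ξ => by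
    rw [FluidPDE.mollifierScale_apply]
    exact mul_nonneg (inv_nonneg.2 (pow_nonneg hε.le _)) (hφ0 _)
  have hkM : ∫ ξ, FluidPDE.mollifierScale ε φ ξ = M := integral_mollifierScale_eq φ hε
  have hkabs : ∫ ξ, |FluidPDE.mollifierScale ε φ ξ| = M := by
    rw [← hkM]; exact integral_congr_ae (ae_of_all _ fun ξ => abs_of_nonneg (hk0 ξ))
  have hkT0 : ∀ ξ, 0 ≤ eyinkTransverseKernel d (FluidPDE.mollifierScale ε φ) ξ := fun ξ =>
    transverseKernel_nonneg hk0 hd1 ξ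
  have hkTM : ∫ ξ, eyinkTransverseKernel d (FluidPDE.mollifierScale ε φ) ξ = cT * M := by
    have hkc : Continuous (FluidPDE.mollifierScale ε φ) := (hφ.mollifierScale hε.ne').smooth.continuous
    have hkcs : HasCompactSupport (FluidPDE.mollifierScale ε φ) := (hφ.mollifierScale hε.ne').hasCompactSupport
    obtain ⟨-, hmass⟩ := integrable_transverseKernel hkc hkcs hk0 hd1
    have e : eyinkTransverseKernel d (FluidPDE.mollifierScale ε φ) =
        fun ξ => ((Fintype.card d : ℝ) - 1) * ∫ s in Ioi (1 : ℝ), s⁻¹ * FluidPDE.mollifierScale ε φ (s • ξ) := by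
      funext ξ; rfl
    rw [e, hmass, hkM]
  have hkTabs : ∫ ξ, |eyinkTransverseKernel d (FluidPDE.mollifierScale ε φ) ξ| = cT * M := by
    rw [← hkTM]; exact integral_congr_ae (ae_of_all _ fun ξ => abs_of_nonneg (hkT0 ξ))
  have hAT : ∀ ξ v : EuclideanSpace ℝ d, ‖projT (‖ξ‖⁻¹ • ξ) v‖ ≤ 2 * ‖v‖ := fun ξ v => norm_projT_unit_le ξ v
  have hAngI : ∀ a c : EuclideanSpace ℝ d, ∫ ξ, FluidPDE.mollifierScale ε φ ξ * ⟪projT (‖ξ‖⁻¹ • ξ) a, c⟫ =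
      (cT * M) * ⟪a, c⟫ := fun a c => by rw [integral_mul_inner_projT hk hkrad a c, hkM]
  have hAngII : ∀ a : EuclideanSpace ℝ d, ∫ ξ, FluidPDE.mollifierScale ε φ ξ * ‖projT (‖ξ‖⁻¹ • ξ) a‖ ^ 2 =
      (cT * M) * ‖a‖ ^ 2 := fun a => by rw [integral_mul_norm_projT_sq hk hkrad a, hkM]
  -- the unfolding lemmas
  have hV : ∀ q : ℝ × UnitAddTorus d, eyinkVelocityT φ ε (u q.1) q.2 =
      ∫ ξ, FluidPDE.mollifierScale ε φ ξ • projT (‖ξ‖⁻¹ • ξ) (uncurry u (stTranslate d ξ q)) := fun q =>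
    (eyink_objectsT_eq φ ε (u q.1) q.2).1
  have hE : ∀ q : ℝ × UnitAddTorus d, eyinkEnergyT φ ε (u q.1) q.2 =
      ∫ ξ, FluidPDE.mollifierScale ε φ ξ * ‖projT (‖ξ‖⁻¹ • ξ) (uncurry u (stTranslate d ξ q))‖ ^ 2 := fun q =>
    (eyink_objectsT_eq φ ε (u q.1) q.2).2.1
  have hF : ∀ q : ℝ × UnitAddTorus d, eyinkEnergyFluxT φ ε (u q.1) q.2 =
      ∫ ξ, (FluidPDE.mollifierScale ε φ ξ * ‖projT (‖ξ‖⁻¹ • ξ) (uncurry u (stTranslate d ξ q))‖ ^ 2) •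
        uncurry u (stTranslate d ξ q) := fun q =>
    (eyink_objectsT_eq φ ε (u q.1) q.2).2.2
  have hP : ∀ q : ℝ × UnitAddTorus d, eyinkPressureT φ ε (p q.1) q.2 =
      ∫ ξ, eyinkTransverseKernel d (FluidPDE.mollifierScale ε φ) ξ * uncurry p (stTranslate d ξ q) := fun q =>
    eyinkPressureT_apply φ ε (p q.1) q.2
  obtain ⟨hAi, hBi, hCi, hDi, hEi, hFi⟩ := eyink_piecesT_integrable hum hu3 hpm hp32 hφ hφ0 hφ1 hε hψ
  -- Type I pieces: value and bound
  have pieceI : ∀ {c : ℝ × UnitAddTorus d → EuclideanSpace ℝ d} (hcm : AEStronglyMeasurable c (stMeasure d T))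
      (hc32 : ∫⁻ q, ‖c q‖ₑ ^ (3 / 2 : ℝ) ∂(stMeasure d T) < ⊤),
      Integrable (fun q : ℝ × UnitAddTorus d => ⟪eyinkVelocityT φ ε (u q.1) q.2, c q⟫) (stMeasure d T) →
      |∫ q, ⟪eyinkVelocityT φ ε (u q.1) q.2, c q⟫ ∂(stMeasure d T)| ≤
        cT * M * |∫ q, ⟪uncurry u q, c q⟫ ∂(stMeasure d T)| + 2 * (m * (∫⁻ q, ‖c q‖ₑ ^ (3 / 2 : ℝ) ∂(stMeasure d T)) ^ (2 / 3 : ℝ)).toReal * M := by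
    intro c hcm hc32 hint
    obtain ⟨hI, hEst⟩ := typeI_estimate (T := T) hk hksupp projT (by norm_num : (0 : ℝ) ≤ 2) hAT continuous_projT hAngI
      hu hu3' hcm hc32 hm hmod
    have hae := ae_inner_integral_kernel_smul_eq (T := T) hk projT hAT continuous_projT hu hu1 c
    have hval : ∫ q, ⟪eyinkVelocityT φ ε (u q.1) q.2, c q⟫ ∂(stMeasure d T) =
        ∫ q, FluidPDE.mollifierScale ε φ q.2 * ⟪projT (‖q.2‖⁻¹ • q.2) (uncurry u (stTranslate d q.2 q.1)), c q.1⟫ ∂((stMeasure d T).prod volume) := by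
      rw [integral_prod _ hI]
      refine integral_congr_ae ?_
      filter_upwards [hae] with q hq
      rw [hV q, hq.2]
    rw [hval, hkabs] at *
    have htri := abs_sub_abs_le_abs_sub
      (∫ q, FluidPDE.mollifierScale ε φ q.2 * ⟪projT (‖q.2‖⁻¹ • q.2) (uncurry u (stTranslate d q.2 q.1)), c q.1⟫ ∂((stMeasure d T).prod volume))
      (cT * M * ∫ q, ⟪uncurry u q, c q⟫ ∂(stMeasure d T))
    rw [abs_mul, abs_of_nonneg (mul_nonneg hcT (integral_nonneg hφ0))] at htri
    linarith
  -- piece A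
  have bA : |∫ t in Ioo 0 T, ∫ x, ⟪u t x, eyinkVelocityT φ ε (u t) x⟫ * FunctionSpaces.Torus.timeDeriv ψ t x| ≤
      cT * M * |XA| + EA * M := by
    have e1 : (∫ t in Ioo 0 T, ∫ x, ⟪u t x, eyinkVelocityT φ ε (u t) x⟫ * FunctionSpaces.Torus.timeDeriv ψ t x) =
        ∫ q, ⟪eyinkVelocityT φ ε (u q.1) q.2, c₁ q⟫ ∂(stMeasure d T) := by
      rw [← integral_prod _ hAi]
      refine integral_congr_ae (ae_of_all _ fun q => ?_)
      simp only [hc₁, real_inner_smul_right]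
      show ⟪uncurry u q, eyinkVelocityT φ ε (u q.1) q.2⟫ * θ q = θ q * ⟪eyinkVelocityT φ ε (u q.1) q.2, uncurry u q⟫
      rw [real_inner_comm]; ring
    have hint : Integrable (fun q : ℝ × UnitAddTorus d => ⟪eyinkVelocityT φ ε (u q.1) q.2, c₁ q⟫) (stMeasure d T) := by
      refine hAi.congr (ae_of_all _ fun q => ?_)
      simp only [hc₁, real_inner_smul_right]
      show ⟪uncurry u q, eyinkVelocityT φ ε (u q.1) q.2⟫ * θ q = θ q * ⟪eyinkVelocityT φ ε (u q.1) q.2, uncurry u q⟫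
      rw [real_inner_comm]; ring
    rw [e1]
    have h := pieceI hc₁m hc₁32 hint
    rw [← hXA, ← hEA] at h
    exact h
  -- piece B
  have bB : |∫ t in Ioo 0 T, ∫ x, ⟪u t x, eyinkVelocityT φ ε (u t) x⟫ * ⟪u t x, FunctionSpaces.Torus.gradient (ψ t) x⟫| ≤
      cT * M * |XB| + EB * M := by
    have e1 : (∫ t in Ioo 0 T, ∫ x, ⟪u t x, eyinkVelocityT φ ε (u t) x⟫ * ⟪u t x, FunctionSpaces.Torus.gradient (ψ t) x⟫) =
        ∫ q, ⟪eyinkVelocityT φ ε (u q.1) q.2, c₂ q⟫ ∂(stMeasure d T) := by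
      rw [← integral_prod _ hBi]
      refine integral_congr_ae (ae_of_all _ fun q => ?_)
      simp only [hc₂, real_inner_smul_right]
      show ⟪uncurry u q, eyinkVelocityT φ ε (u q.1) q.2⟫ * g q = g q * ⟪eyinkVelocityT φ ε (u q.1) q.2, uncurry u q⟫
      rw [real_inner_comm]; ring
    have hint : Integrable (fun q : ℝ × UnitAddTorus d => ⟪eyinkVelocityT φ ε (u q.1) q.2, c₂ q⟫) (stMeasure d T) := by
      refine hBi.congr (ae_of_all _ fun q => ?_)
      simp only [hc₂, real_inner_smul_right]
      show ⟪uncurry u q, eyinkVelocityT φ ε (u q.1) q.2⟫ * g q = g q * ⟪eyinkVelocityT φ ε (u q.1) q.2, uncurry u q⟫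
      rw [real_inner_comm]; ring
    rw [e1]
    have h := pieceI hc₂m hc₂32 hint
    rw [← hXB, ← hEB] at h
    exact h
  -- piece E
  have bE : |∫ t in Ioo 0 T, ∫ x, p t x * ⟪eyinkVelocityT φ ε (u t) x, FunctionSpaces.Torus.gradient (ψ t) x⟫| ≤
      cT * M * |XE| + EE * M := by
    have e1 : (∫ t in Ioo 0 T, ∫ x, p t x * ⟪eyinkVelocityT φ ε (u t) x, FunctionSpaces.Torus.gradient (ψ t) x⟫) =
        ∫ q, ⟪eyinkVelocityT φ ε (u q.1) q.2, c₃ q⟫ ∂(stMeasure d T) := by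
      rw [← integral_prod _ hEi]
      refine integral_congr_ae (ae_of_all _ fun q => ?_)
      simp only [hc₃, real_inner_smul_right]
      rfl
    have hint : Integrable (fun q : ℝ × UnitAddTorus d => ⟪eyinkVelocityT φ ε (u q.1) q.2, c₃ q⟫) (stMeasure d T) := by
      refine hEi.congr (ae_of_all _ fun q => ?_)
      simp only [hc₃, real_inner_smul_right]
      rfl
    rw [e1]
    have h := pieceI hc₃m hc₃32 hint
    rw [← hXE, ← hEE] at h
    exact h
  -- piece C (Type III)
  have bC : |∫ t in Ioo 0 T, ∫ x, ⟪eyinkEnergyFluxT φ ε (u t) x, FunctionSpaces.Torus.gradient (ψ t) x⟫| ≤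
      cT * M * |XC| + EC * M := by
    obtain ⟨hI, hEst⟩ := typeIII_estimate (T := T) hk hksupp projT (by norm_num : (0 : ℝ) ≤ 2) hAT continuous_projT hAngII
      hu hu3' hHm' hCψ (fun q => hHb q.1 q.2) hm hmod
    have hae := ae_inner_integral_kernel_normSq_smul_eq (T := T) hk projT hAT continuous_projT hu hu3' Hψ
    have hval : (∫ t in Ioo 0 T, ∫ x, ⟪eyinkEnergyFluxT φ ε (u t) x, FunctionSpaces.Torus.gradient (ψ t) x⟫) =
        ∫ q, FluidPDE.mollifierScale ε φ q.2 * (‖projT (‖q.2‖⁻¹ • q.2) (uncurry u (stTranslate d q.2 q.1))‖ ^ 2 *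
          ⟪uncurry u (stTranslate d q.2 q.1), Hψ q.1⟫) ∂((stMeasure d T).prod volume) := by
      rw [← integral_prod _ hCi, integral_prod _ hI]
      refine integral_congr_ae ?_
      filter_upwards [hae] with q hq
      rw [hF q, hq.2]
    rw [hval]
    rw [hkabs, ← hXC, ← hN3, ← hEC] at hEst
    have htri := abs_sub_abs_le_abs_sub
      (∫ q, FluidPDE.mollifierScale ε φ q.2 * (‖projT (‖q.2‖⁻¹ • q.2) (uncurry u (stTranslate d q.2 q.1))‖ ^ 2 *
          ⟪uncurry u (stTranslate d q.2 q.1), Hψ q.1⟫) ∂((stMeasure d T).prod volume))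
      (cT * M * XC)
    rw [abs_mul, abs_of_nonneg (mul_nonneg hcT (integral_nonneg hφ0))] at htri
    linarith
  -- piece D (Type II)
  have bD : |∫ t in Ioo 0 T, ∫ x, eyinkEnergyT φ ε (u t) x * ⟪u t x, FunctionSpaces.Torus.gradient (ψ t) x⟫| ≤
      cT * M * |XC| + ED * M := by
    obtain ⟨hI, hEst⟩ := typeII_estimate (T := T) hk hksupp projT (by norm_num : (0 : ℝ) ≤ 2) hAT continuous_projT hAngII
      hu hu3' hgm hg3 hm hmod
    have hval : (∫ t in Ioo 0 T, ∫ x, eyinkEnergyT φ ε (u t) x * ⟪u t x, FunctionSpaces.Torus.gradient (ψ t) x⟫) =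
        ∫ q, FluidPDE.mollifierScale ε φ q.2 * (‖projT (‖q.2‖⁻¹ • q.2) (uncurry u (stTranslate d q.2 q.1))‖ ^ 2 * g q.1)
          ∂((stMeasure d T).prod volume) := by
      rw [← integral_prod _ hDi, integral_prod _ hI]
      refine integral_congr_ae (ae_of_all _ fun q => ?_)
      simp only
      rw [hE q, ← integral_mul_const]
      refine integral_congr_ae (ae_of_all _ fun ξ => ?_)
      simp only
      rw [show ⟪u q.1 q.2, FunctionSpaces.Torus.gradient (ψ q.1) q.2⟫ = g q from rfl]
      ring
    rw [hval]
    have eX : (∫ q, ‖uncurry u q‖ ^ 2 * g q ∂(stMeasure d T)) = XC := by rw [hXC]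
    rw [hkabs, eX, ← hN3, ← hNG, ← hED] at hEst
    have htri := abs_sub_abs_le_abs_sub
      (∫ q, FluidPDE.mollifierScale ε φ q.2 * (‖projT (‖q.2‖⁻¹ • q.2) (uncurry u (stTranslate d q.2 q.1))‖ ^ 2 * g q.1)
          ∂((stMeasure d T).prod volume))
      (cT * M * XC)
    rw [abs_mul, abs_of_nonneg (mul_nonneg hcT (integral_nonneg hφ0))] at htri
    linarith
  -- piece F (Type IV)
  have bF : |∫ t in Ioo 0 T, ∫ x, eyinkPressureT φ ε (p t) x * ⟪u t x, FunctionSpaces.Torus.gradient (ψ t) x⟫| ≤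
      cT * M * |XF| + cT * EF * M := by
    obtain ⟨hI, hEst⟩ := typeIV_estimate (T := T) hkT hkTsupp hp hp32' hgm hg3 hmP hmodP
    have hval : (∫ t in Ioo 0 T, ∫ x, eyinkPressureT φ ε (p t) x * ⟪u t x, FunctionSpaces.Torus.gradient (ψ t) x⟫) =
        ∫ q, eyinkTransverseKernel d (FluidPDE.mollifierScale ε φ) q.2 * (uncurry p (stTranslate d q.2 q.1) * g q.1)
          ∂((stMeasure d T).prod volume) := by
      rw [← integral_prod _ hFi, integral_prod _ hI]
      refine integral_congr_ae (ae_of_all _ fun q => ?_)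
      simp only
      rw [hP q, ← integral_mul_const]
      refine integral_congr_ae (ae_of_all _ fun ξ => ?_)
      simp only
      rw [show ⟪u q.1 q.2, FunctionSpaces.Torus.gradient (ψ q.1) q.2⟫ = g q from rfl]
      ring
    rw [hval]
    rw [hkTabs, hkTM, ← hXF, ← hNG, ← hEF] at hEst
    have htri := abs_sub_abs_le_abs_sub
      (∫ q, eyinkTransverseKernel d (FluidPDE.mollifierScale ε φ) q.2 * (uncurry p (stTranslate d q.2 q.1) * g q.1)
          ∂((stMeasure d T).prod volume))
      (cT * M * XF)
    rw [abs_mul, abs_of_nonneg (mul_nonneg hcT (integral_nonneg hφ0))] at htri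
    linarith
  -- assemble
  rw [eyinkBalanceT_eq_sum hum hu3 hpm hp32 hφ hφ0 hφ1 hε hψ]
  have hM0 : 0 ≤ M := integral_nonneg hφ0
  set A := ∫ t in Ioo 0 T, ∫ x, ⟪u t x, eyinkVelocityT φ ε (u t) x⟫ * FunctionSpaces.Torus.timeDeriv ψ t x
  set B := ∫ t in Ioo 0 T, ∫ x, ⟪u t x, eyinkVelocityT φ ε (u t) x⟫ * ⟪u t x, FunctionSpaces.Torus.gradient (ψ t) x⟫
  set Cc := ∫ t in Ioo 0 T, ∫ x, ⟪eyinkEnergyFluxT φ ε (u t) x, FunctionSpaces.Torus.gradient (ψ t) x⟫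
  set D := ∫ t in Ioo 0 T, ∫ x, eyinkEnergyT φ ε (u t) x * ⟪u t x, FunctionSpaces.Torus.gradient (ψ t) x⟫
  set E := ∫ t in Ioo 0 T, ∫ x, p t x * ⟪eyinkVelocityT φ ε (u t) x, FunctionSpaces.Torus.gradient (ψ t) x⟫
  set F := ∫ t in Ioo 0 T, ∫ x, eyinkPressureT φ ε (p t) x * ⟪u t x, FunctionSpaces.Torus.gradient (ψ t) x⟫
  have e2 : ∀ y : ℝ, |2 * y| = 2 * |y| := fun y => by rw [abs_mul, abs_of_pos two_pos]
  calc |2 * A + 2 * B + Cc - D + 2 * E + 2 * F|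
      ≤ 2 * |A| + 2 * |B| + |Cc| + |D| + 2 * |E| + 2 * |F| := by
        have h1 : |2 * A + 2 * B + Cc - D + 2 * E + 2 * F| ≤ |2 * A + 2 * B + Cc - D + 2 * E| + |2 * F| := abs_add_le _ _
        have h2 : |2 * A + 2 * B + Cc - D + 2 * E| ≤ |2 * A + 2 * B + Cc - D| + |2 * E| := abs_add_le _ _
        have h3 : |2 * A + 2 * B + Cc - D| ≤ |2 * A + 2 * B + Cc| + |D| := abs_sub _ _
        have h4 : |2 * A + 2 * B + Cc| ≤ |2 * A + 2 * B| + |Cc| := abs_add_le _ _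
        have h5 : |2 * A + 2 * B| ≤ |2 * A| + |2 * B| := abs_add_le _ _
        rw [e2, e2] at h5
        rw [e2] at h2 h1
        linarith
    _ ≤ 2 * (cT * M * |XA| + EA * M) + 2 * (cT * M * |XB| + EB * M) + (cT * M * |XC| + EC * M) +
          (cT * M * |XC| + ED * M) + 2 * (cT * M * |XE| + EE * M) + 2 * (cT * M * |XF| + cT * EF * M) := by
        linarith [bA, bB, bC, bD, bE, bF]
    _ = (2 * (cT * |XA| + EA) + 2 * (cT * |XB| + EB) + (cT * |XC| + EC) + (cT * |XC| + ED) +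
          2 * (cT * |XE| + EE) + 2 * (cT * |XF| + cT * EF)) * M := by ring

end MassBound

/-! ## Assembly: the transverse balance for every radial mollifier -/

section Assembly

variable [DecidableEq d] {T : ℝ} {u : ℝ → UnitAddTorus d → EuclideanSpace ℝ d}
  {p : ℝ → UnitAddTorus d → ℝ} {ψ : ℝ → UnitAddTorus d → ℝ} {φ : EuclideanSpace ℝ d → ℝ} {ε : ℝ}

/-- **The transverse balance at scale `ε` for nonnegative radial bumps in the unit ball** (no
excision): `𝓔_T^{ε,φ}(ψ) = (4(d−1)/d) ∫∫ D_T^{ε,φ} ψ`. Split `φ = φ(1 − χ_κ) + φχ_κ`; both sides are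
additive in the profile (`eyinkBalanceT_add`, `integral_transverseApprox_add`), the identity holds for
the excised profile (`eyinkBalanceT_eq_of_matrix_facts`), and both remainders tend to `0` as `κ → 0⁺`
(`exists_abs_eyinkBalanceT_le` with `∫ φχ_κ → 0`, `tendsto_integral_transverseApprox_remainder`).
[cite: Eyink2003, §2 (uuT-eq)] -/
theorem eyinkBalanceT_eq_of_matrix_facts' (hd : 2 ≤ Fintype.card d)
    (h1 : integral_matKernelFlux_mul_eq (d := d))
    (h2 : IsDistributionalNSSolutionOn.matSymmTestField_identity (d := d))
    (hsol : IsDistributionalNSSolutionOn T 0 0 u p)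
    (hu3 : ∫⁻ t in Ioo 0 T, ∫⁻ x, ‖u t x‖ₑ ^ 3 < ⊤)
    (hp32 : ∫⁻ t in Ioo 0 T, ∫⁻ x, ‖p t x‖ₑ ^ (3 / 2 : ℝ) < ⊤)
    (hφ : IsRadialBump φ) (hφ0 : ∀ ξ, 0 ≤ φ ξ) (hφ1 : ∀ ξ, 1 < ‖ξ‖ → φ ξ = 0) (hε : 0 < ε)
    (hψ : FunctionSpaces.Torus.IsSpaceTimeTestIoo T ψ) :
    eyinkBalanceT T u p φ ε ψ =
      4 * ((Fintype.card d : ℝ) - 1) / Fintype.card d * ∫ t in Ioo 0 T, ∫ x, eyinkTransverseApprox φ ε (u t) x * ψ t x := by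
  haveI : Nonempty d := Fintype.card_pos_iff.1 (by omega)
  set c : ℝ := 4 * ((Fintype.card d : ℝ) - 1) / Fintype.card d with hc
  -- product forms of the data for the pairing lemmas
  have hu : AEStronglyMeasurable (uncurry u) ((volume.restrict (Ioo 0 T)).prod volume) :=
    aestronglyMeasurable_uncurry_prod_of_stLift_Ioo hsol.1
  have hu3' : ∫⁻ q, ‖uncurry u q‖ₑ ^ 3 ∂((volume.restrict (Ioo 0 T)).prod volume) < ⊤ := lintegral_prod_enorm_pow_three_lt_top hu hu3
  have hψm : AEStronglyMeasurable (uncurry ψ) ((volume.restrict (Ioo 0 T)).prod volume) := hψ.continuous_uncurry.aestronglyMeasurable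
  obtain ⟨Cψ, hψb⟩ := hψ.exists_abs_le
  obtain ⟨C, hC0, hC⟩ := exists_abs_eyinkBalanceT_le (T := T) (u := u) (p := p) hsol.1 hu3 hsol.2.2.1 hp32 hψ
  set P : (EuclideanSpace ℝ d → ℝ) → ℝ := fun φ' => ∫ t in Ioo 0 T, ∫ x, eyinkTransverseApprox φ' ε (u t) x * ψ t x with hP
  -- the defect `balance(φ) − c P(φ)` equals the defect of the remainder, for every `κ > 0`
  have hdef : ∀ κ, 0 < κ → eyinkBalanceT T u p φ ε ψ - c * P φ =
      eyinkBalanceT T u p (remainder φ κ) ε ψ - c * P (remainder φ κ) := by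
    intro κ hκ
    have hex : IsRadialBump (excise φ κ) := hφ.excise κ
    have hre : IsRadialBump (remainder φ κ) := hφ.remainder κ
    have hex0 : ∀ ξ, 0 ≤ excise φ κ ξ := excise_nonneg hφ0 κ
    have hre0 : ∀ ξ, 0 ≤ remainder φ κ ξ := remainder_nonneg hφ0 κ
    have hex1 : ∀ ξ, 1 < ‖ξ‖ → excise φ κ ξ = 0 := fun ξ hξ => excise_eq_zero_of κ (hφ1 ξ hξ)
    have hre1 : ∀ ξ, 1 < ‖ξ‖ → remainder φ κ ξ = 0 := fun ξ hξ => remainder_eq_zero_of κ (hφ1 ξ hξ)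
    have hsum : (fun ξ => excise φ κ ξ + remainder φ κ ξ) = φ := funext (excise_add_remainder φ κ)
    have hB := eyinkBalanceT_add (T := T) (u := u) (p := p) hsol.1 hu3 hsol.2.2.1 hp32 hex hex0 hex1 hre hre0 hre1 hε hψ
    have hPadd := integral_transverseApprox_add (T := T) (u := u) (ψ := ψ) hd hex hre hu hu3' hψm hψb hε
    rw [hsum] at hB hPadd
    have hexid := eyinkBalanceT_eq_of_matrix_facts hd h1 h2 hsol hu3 hp32 hex hex0 hex1 (half_pos hκ)
      (fun ξ hξ => excise_eq_zero_of_lt hκ hξ) hε hψ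
    change eyinkBalanceT T u p (excise φ κ) ε ψ = c * P (excise φ κ) at hexid
    change P φ = P (excise φ κ) + P (remainder φ κ) at hPadd
    rw [hB, hPadd, hexid]
    ring
  -- both remainder terms tend to zero
  have hφi : Integrable φ volume := hφ.smooth.continuous.integrable_of_hasCompactSupport hφ.hasCompactSupport
  have hR1 : Tendsto (fun κ => eyinkBalanceT T u p (remainder φ κ) ε ψ) (𝓝[>] (0 : ℝ)) (𝓝 0) := by
    have hm := tendsto_integral_remainder (φ := φ) hφi hφ0 hφ.smooth.continuous
    rw [tendsto_zero_iff_abs_tendsto_zero]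
    refine squeeze_zero' (Eventually.of_forall fun κ => abs_nonneg _) ?_ (by simpa using hm.const_mul C)
    filter_upwards [self_mem_nhdsWithin] with κ hκ
    exact hC (hφ.remainder κ) (remainder_nonneg hφ0 κ) (fun ξ hξ => remainder_eq_zero_of κ (hφ1 ξ hξ)) hε
  have hR2 : Tendsto (fun κ => P (remainder φ κ)) (𝓝[>] (0 : ℝ)) (𝓝 0) :=
    tendsto_integral_transverseApprox_remainder (T := T) (u := u) (ψ := ψ) hd hφ hu hu3' hψm hψb hε
  have hlim : Tendsto (fun κ => eyinkBalanceT T u p (remainder φ κ) ε ψ - c * P (remainder φ κ)) (𝓝[>] (0 : ℝ)) (𝓝 0) := by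
    simpa using hR1.sub (hR2.const_mul c)
  have hconst : Tendsto (fun _ : ℝ => eyinkBalanceT T u p φ ε ψ - c * P φ) (𝓝[>] (0 : ℝ)) (𝓝 0) := by
    refine hlim.congr' ?_
    filter_upwards [self_mem_nhdsWithin] with κ hκ
    exact (hdef κ hκ).symm
  have h0 : eyinkBalanceT T u p φ ε ψ - c * P φ = 0 := tendsto_nhds_unique tendsto_const_nhds hconst
  linarith

/-- **Eyink's transverse balance `(uuT-eq)` at scale `ε`, from the two matrix-kernel facts**, for every
spherically symmetric standard mollifier (any support radius: rescale to the unit ball, the objects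
depending on `φ` only through `φ^ε = (φ_R)^{εR}`). [cite: Eyink2003, §2 (uuT-eq)] -/
theorem eyink_transverse_balance_of_matrix_facts
    (h1 : integral_matKernelFlux_mul_eq (d := d))
    (h2 : IsDistributionalNSSolutionOn.matSymmTestField_identity (d := d)) :
    eyink_transverse_balance (d := d) := by
  intro T u p hd hsol hu3 hp φ hφ hrad ε hε ψ hψ
  -- support radius
  obtain ⟨R₀, hR₀⟩ := hφ.2.1.exists_tsupport_subset_closedBall
  set R : ℝ := max R₀ 0 + 1 with hRdef
  have hR : 0 < R := by positivity
  have hsupp : ∀ ξ : EuclideanSpace ℝ d, R < ‖ξ‖ → φ ξ = 0 := by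
    intro ξ hξ
    refine image_eq_zero_of_notMem_tsupport fun h => ?_
    have h' := hR₀ h
    rw [mem_closedBall, dist_zero_right] at h'
    have : R₀ < R := by have := le_max_left R₀ 0; linarith
    linarith
  obtain ⟨hb, hb0, hb1⟩ := rescale_facts hφ hrad hR hsupp
  have hk : FluidPDE.mollifierScale (ε * R) (FluidPDE.mollifierScale R⁻¹ φ) = FluidPDE.mollifierScale ε φ :=
    mollifierScale_mul_mollifierScale_inv φ hR ε
  rw [← eyinkBalanceT_congr_kernel hk, ← eyinkTransverseApprox_congr_kernel hk]
  exact eyinkBalanceT_eq_of_matrix_facts' hd h1 h2 hsol hu3 hp hb hb0 hb1 (mul_pos hε hR) hψ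

/-- **Discharge of the named fact `Torus.eyink_transverse_balance`** (`EyinkBalance`): both matrix
facts are proved in the tree (`Torus.integral_matKernelFlux_mul_eq_holds`,
`Torus.IsDistributionalNSSolutionOn.matSymmTestField_identity_holds`). [cite: Eyink2003, §2 (uuT-eq)] -/
theorem eyink_transverse_balance_holds : eyink_transverse_balance (d := d) :=
  eyink_transverse_balance_of_matrix_facts integral_matKernelFlux_mul_eq_holds
    IsDistributionalNSSolutionOn.matSymmTestField_identity_holds

end Assembly

end Literature.Analysis.FluidPDE.Torus
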